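import Summits.ABC.IUTFork.Joshi.TestRealHonestPacket
import HarnessLib

/-!
# Branch E TEST vs S — REAL-LEVEL NON-VACUITY, companion: X-06-REAL at the Dupuy–Hilado binders, and pinned readings EXIST
# (abc-iut-E-t41; item named by abc-iut-E-cx 2026-08-26T09:41:25Z)

Companion of `Joshi/TestRealHonestPacket.lean` (the honest packet at the tree's real carriers: `honestSetting` over abc-iut-E-t43's
`latticeSituationReal` for EVERY (Ind1)/(Ind2) binder `Aut`/`Ism`, with `ThetaRegionsAdm`/`hq`/`hΘ`/`hlt` DISCHARGED and X-12-REAL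
fired non-vacuously). PROOF-ONLY but for the witness reading `rho0`. Two things:

* `honestDH_not_indCoversQ` — **X-06-REAL IS NON-VACUOUS**: at the Dupuy–Hilado binders (`stripAutDH`, `ismDH logv`: the lattice
  ISOMETRIES of abc-iut-c312-5's `Thm311RealDH`) the re-typed container satisfies the generator hypotheses
  (`generatorsPreserve_summandPiecesReal_DH` = c312-5's `generatorsPreserve_summandPiecesDH`, same data), so E-t43's
  `not_indCoversQ_of_realizes` (Joshi/TestRealInstantiation.lean, p430041) FIRES at the honest setting for every column family and
  every reading `ρ` / `q`-datum `qK` satisfying the Corollary's own two region pins there: NO element of `⟨(Ind1) ∪ (Ind2)⟩` carries a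
  Θ-datum region over the `q`-datum region — S is unreachable by indeterminacy moves AT AN INHABITED honest real setting.
* `exists_pinnedReading'` — the class of PINNED READINGS of the honest setting is INHABITED for EVERY column family: by Cantor
  (`exists_qDatum_ne`: a `ℤ`-indexed family of Θ-data never exhausts the subsets of the infinite packet `⊕_j 𝓘(^{S^±_{j+1}};𝒟^⊢_v)`,
  `packet_nontrivial_real`) some `q`-datum `qK` misses all the column's Θ-data, and then the reading `rho0` (the `q`-datum ↦ the
  `q`-pilot hull-set `e⁻¹(𝒪_L)`, every other datum ↦ the Θ-box region `e⁻¹(p·𝒪_L)`) satisfies (pΘ) `thetaRegion m = rho0 (frobΨ m)`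
  (the Θ-boxes do not depend on `m`) and (pq′) `qRegion = rho0 qK` (`exists_pinnedReading`). `rho0` is a WITNESS, not a reading of
  print: the (hρ)-equivariance half of the Θ-pin is NOT claimed for it.

**No side is taken** on [IUTchIII] Cor. 3.12 or on any author (Mochizuki / Scholze–Stix / Joshi / Dupuy–Hilado); typed ≠ proved ≠
endorsed; located, not adjudicated. [claim: Mochizuki2012, status: disputed] [cite: DupuyHilado2025, §4.7–4.9]. Standard axioms only;
no `sorry`; R14: a `Joshi/Test*` file.
-/

noncomputable section

open Set Function

namespace Summit.ABC.IUTFork.Joshi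

open Thm311 Thm311.Real Cor312 Cor312Vol Literature.IUT.LogThetaLattice Literature.IUT.LogVolume

/-! ## 1. Pinned readings EXIST -/

section Exists

variable {F : Type} [Field F] [NumberField F] (X : PilotData F) {logv : PadicLogs F} (hlog : LogvAnalytic logv)
  (Aut Ism : ∀ x : Place F, Set (Carrier x ≃ₗ[ℚ] Carrier x))
  (hAut : ∀ x, LinearEquiv.refl ℚ (Carrier x) ∈ Aut x) (hIsm : ∀ x, LinearEquiv.refl ℚ (Carrier x) ∈ Ism x)
  (M : Type) [Field M] [NumberField M]
  (archPk : ∀ (j : (thetaIndex X).Label) (vQ : (thetaIndex X).VQ), Set ((logShells X logv Aut Ism hAut hIsm).Packet j vQ))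
  (archSub : ∀ (j : (thetaIndex X).Label) (v : (thetaIndex X).V),
    Set ((logShells X logv Aut Ism hAut hIsm).Packet j ((thetaIndex X).over v)))
  (Ψ : ℤ → ∀ v : (thetaIndex X).V, v ∈ (thetaIndex X).Vbad → Set ((logShells X logv Aut Ism hAut hIsm).StarPacket v))
  (act : ℤ → ∀ v : (thetaIndex X).V, v ∈ (thetaIndex X).Vbad →
    (logShells X logv Aut Ism hAut hIsm).StarPacket v → Module.End ℚ ((logShells X logv Aut Ism hAut hIsm).StarPacket v))
  (Mmod : ℤ → ∀ j : (thetaIndex X).LabelStar, Set ((logShells X logv Aut Ism hAut hIsm).GlobalPacket j.1))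
  (region : ℤ → ∀ j : (thetaIndex X).LabelStar, FinDivisor M → ∀ vQ : (thetaIndex X).VQ,
    Set ((logShells X logv Aut Ism hAut hIsm).Packet j.1 vQ))
  (col : ℤ → Column (logShells X logv Aut Ism hAut hIsm)) (n : ℤ) (p : ℕ)
  (qK : ∀ v : (thetaIndex X).V, v ∈ (thetaIndex X).Vbad → Set ((logShells X logv Aut Ism hAut hIsm).StarPacket v))

open scoped Classical in
/-- **The reading `rho0`**: the `q`-datum ↦ the `q`-pilot hull-set `e⁻¹(𝒪_L)`, every other datum ↦ the Θ-box region `e⁻¹(p·𝒪_L)`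
of the honest setting. A WITNESS that pinned readings exist; not a reading of print. [folklore] -/
def rho0 (Ψ' : ∀ v : (thetaIndex X).V, v ∈ (thetaIndex X).Vbad → Set ((logShells X logv Aut Ism hAut hIsm).StarPacket v))
    (j : (thetaIndex X).Label) (vQ : (thetaIndex X).VQ) : Set ((logShells X logv Aut Ism hAut hIsm).Packet j vQ) :=
  if Ψ' = qK then (honestSetting X hlog Aut Ism hAut hIsm M archPk archSub Ψ act Mmod region col n p).qRegion j vQ
  else (honestSetting X hlog Aut Ism hAut hIsm M archPk archSub Ψ act Mmod region col n p).thetaRegion 0 j vQ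

/-- **Pinned readings EXIST**: for every column family whose Θ-data miss the `q`-datum, `rho0` satisfies (pΘ) and (pq′) at the
honest setting (its Θ-boxes `e⁻¹(p·𝒪_L)` do not depend on `m`). [folklore] -/
theorem exists_pinnedReading (hsep : ∀ m : ℤ, (col n).frobΨ m ≠ qK) :
    ∃ ρ : (∀ v : (thetaIndex X).V, v ∈ (thetaIndex X).Vbad → Set ((logShells X logv Aut Ism hAut hIsm).StarPacket v)) →
        ∀ (j : (thetaIndex X).Label) (vQ : (thetaIndex X).VQ), Set ((logShells X logv Aut Ism hAut hIsm).Packet j vQ),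
      (∀ (m : ℤ) (j : (thetaIndex X).Label) (vQ : (thetaIndex X).VQ),
        (honestSetting X hlog Aut Ism hAut hIsm M archPk archSub Ψ act Mmod region col n p).thetaRegion m j vQ =
          ρ ((col n).frobΨ m) j vQ) ∧
      ∀ (j : (thetaIndex X).Label) (vQ : (thetaIndex X).VQ),
        (honestSetting X hlog Aut Ism hAut hIsm M archPk archSub Ψ act Mmod region col n p).qRegion j vQ = ρ qK j vQ := by
  classical
  refine ⟨rho0 X hlog Aut Ism hAut hIsm M archPk archSub Ψ act Mmod region col n p qK, fun m j vQ => ?_, fun j vQ => ?_⟩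
  · unfold rho0
    rw [if_neg (hsep m)]
    rfl
  · unfold rho0
    rw [if_pos rfl]


/-! ### For EVERY column family the `q`-datum can be chosen off its Θ-data (Cantor), so pinned readings ALWAYS exist -/

omit [NumberField M] in
/-- The tensor packets of the real shells are NONTRIVIAL `ℚ`-modules (`K_v ≠ 0`, fibres nonempty; a tensor basis vector).
[folklore] -/
theorem packet_nontrivial_real (j : (thetaIndex X).Label) (vQ : (thetaIndex X).VQ) :
    Nontrivial ((logShells X logv Aut Ism hAut hIsm).Packet j vQ) := by
  classical
  obtain ⟨v₀⟩ := (inferInstance : Nonempty ((thetaIndex X).Fibre vQ))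
  haveI : Inhabited ((thetaIndex X).Fibre vQ) := ⟨v₀⟩
  haveI : Nontrivial ((logShells X logv Aut Ism hAut hIsm).Packet1 vQ) :=
    (inferInstance : Nontrivial (∀ v : (thetaIndex X).Fibre vQ, Carrier v.1))
  let b : (thetaIndex X).Caps j →
      Module.Basis (Module.Free.ChooseBasisIndex ℚ ((logShells X logv Aut Ism hAut hIsm).Packet1 vQ)) ℚ
        ((logShells X logv Aut Ism hAut hIsm).Packet1 vQ) := fun _ => Module.Free.chooseBasis ℚ _
  haveI : Nonempty (Module.Free.ChooseBasisIndex ℚ ((logShells X logv Aut Ism hAut hIsm).Packet1 vQ)) :=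
    (b 0).index_nonempty
  obtain ⟨q⟩ : Nonempty ((thetaIndex X).Caps j →
    Module.Free.ChooseBasisIndex ℚ ((logShells X logv Aut Ism hAut hIsm).Packet1 vQ)) := inferInstance
  exact ⟨⟨Basis.piTensorProduct b q, 0, (Basis.piTensorProduct b).ne_zero q⟩⟩

omit [NumberField M] in
/-- An injection `ℤ ↪ ⊕_{j ∈ 𝔽_l^⋇} 𝓘(^{S^±_{j+1}};𝒟^⊢_v)` (integer multiples of a nonzero vector at the label `1`). [folklore] -/
theorem exists_injective_int_starPacket (v : (thetaIndex X).V) :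
    ∃ e : ℤ → (logShells X logv Aut Ism hAut hIsm).StarPacket v, Function.Injective e := by
  classical
  let j₁ : (thetaIndex X).LabelStar :=
    ⟨Setting.labelSucc ⟨0, lt_of_lt_of_le Nat.zero_lt_two (thetaIndex X).two_le_lstar⟩, Setting.labelSucc_ne_zero _⟩
  haveI := packet_nontrivial_real X Aut Ism hAut hIsm (logv := logv) j₁.1 ((thetaIndex X).over v)
  obtain ⟨x₀, hx₀⟩ := exists_ne (0 : (logShells X logv Aut Ism hAut hIsm).Packet j₁.1 ((thetaIndex X).over v))
  refine ⟨fun m => (m : ℚ) • Pi.single j₁ x₀, fun m m' h => ?_⟩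
  have h1 := congrFun h j₁
  simp only [Pi.smul_apply, Pi.single_eq_same] at h1
  exact_mod_cast smul_left_injective ℚ hx₀ h1

omit [NumberField M] in
/-- **For EVERY family of Θ-data `m ↦ Ψ_m` there is a `q`-datum equal to NONE of them** (Cantor: `ℤ`-indexed families do not
exhaust the subsets of an infinite packet). [folklore] -/
theorem exists_qDatum_ne
    (f : ℤ → ∀ v : (thetaIndex X).V, v ∈ (thetaIndex X).Vbad → Set ((logShells X logv Aut Ism hAut hIsm).StarPacket v)) :
    ∃ qK : ∀ v : (thetaIndex X).V, v ∈ (thetaIndex X).Vbad → Set ((logShells X logv Aut Ism hAut hIsm).StarPacket v),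
      ∀ m : ℤ, f m ≠ qK := by
  classical
  obtain ⟨v₀, hv₀⟩ := (thetaIndex X).Vbad_nonempty
  obtain ⟨e, he⟩ := exists_injective_int_starPacket X Aut Ism hAut hIsm (logv := logv) v₀
  have hns := Function.cantor_surjective
    (fun y : (logShells X logv Aut Ism hAut hIsm).StarPacket v₀ => f (Function.invFun e y) v₀ hv₀)
  simp only [Function.Surjective, not_forall, not_exists] at hns
  obtain ⟨A, hA⟩ := hns
  refine ⟨fun v _ => if h : v = v₀ then h ▸ A else ∅, fun m hm => hA (e m) ?_⟩
  have h1 := congrFun (congrFun hm v₀) hv₀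
  rw [dif_pos rfl] at h1
  rw [Function.leftInverse_invFun he m]
  exact h1

/-- **Pinned readings ALWAYS exist**: for EVERY column family there are a region reading `ρ` and a `q`-datum `qK` satisfying
(pΘ) and (pq′) at the honest setting. [folklore] -/
theorem exists_pinnedReading' :
    ∃ (ρ : (∀ v : (thetaIndex X).V, v ∈ (thetaIndex X).Vbad → Set ((logShells X logv Aut Ism hAut hIsm).StarPacket v)) →
        ∀ (j : (thetaIndex X).Label) (vQ : (thetaIndex X).VQ), Set ((logShells X logv Aut Ism hAut hIsm).Packet j vQ))
      (qK : ∀ v : (thetaIndex X).V, v ∈ (thetaIndex X).Vbad → Set ((logShells X logv Aut Ism hAut hIsm).StarPacket v)),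
      (∀ (m : ℤ) (j : (thetaIndex X).Label) (vQ : (thetaIndex X).VQ),
        (honestSetting X hlog Aut Ism hAut hIsm M archPk archSub Ψ act Mmod region col n p).thetaRegion m j vQ =
          ρ ((col n).frobΨ m) j vQ) ∧
      ∀ (j : (thetaIndex X).Label) (vQ : (thetaIndex X).VQ),
        (honestSetting X hlog Aut Ism hAut hIsm M archPk archSub Ψ act Mmod region col n p).qRegion j vQ = ρ qK j vQ := by
  obtain ⟨qK, hqK⟩ := exists_qDatum_ne X Aut Ism hAut hIsm (logv := logv) (col n).frobΨ
  obtain ⟨ρ, hρ⟩ := exists_pinnedReading X hlog Aut Ism hAut hIsm M archPk archSub Ψ act Mmod region col n p qK hqK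
  exact ⟨ρ, qK, hρ⟩

end Exists

/-! ## 2. At the Dupuy–Hilado binders: X-06-REAL IS NON-VACUOUS (the first horn outright) -/

section DH

variable {F : Type} [Field F] [NumberField F] (X : PilotData F) {logv : PadicLogs F} (hlog : LogvAnalytic logv)
  {M : Type} [Field M] [NumberField M]
  {archPk : ∀ (j : (thetaIndex X).Label) (vQ : (thetaIndex X).VQ), Set ((logShellsDH X logv).Packet j vQ)}
  {archSub : ∀ (j : (thetaIndex X).Label) (v : (thetaIndex X).V), Set ((logShellsDH X logv).Packet j ((thetaIndex X).over v))}
  {Ψ : ℤ → ∀ v : (thetaIndex X).V, v ∈ (thetaIndex X).Vbad → Set ((logShellsDH X logv).StarPacket v)}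
  {act : ℤ → ∀ v : (thetaIndex X).V, v ∈ (thetaIndex X).Vbad →
    (logShellsDH X logv).StarPacket v → Module.End ℚ ((logShellsDH X logv).StarPacket v)}
  {Mmod : ℤ → ∀ j : (thetaIndex X).LabelStar, Set ((logShellsDH X logv).GlobalPacket j.1)}
  {region : ℤ → ∀ j : (thetaIndex X).LabelStar, FinDivisor M → ∀ vQ : (thetaIndex X).VQ, Set ((logShellsDH X logv).Packet j.1 vQ)}
  {col : ℤ → Column (logShellsDH X logv)} {n : ℤ} {p : ℕ} [hp : Fact p.Prime]
  {ρ : (∀ v : (thetaIndex X).V, v ∈ (thetaIndex X).Vbad → Set ((logShellsDH X logv).StarPacket v)) →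
    ∀ (j : (thetaIndex X).Label) (vQ : (thetaIndex X).VQ), Set ((logShellsDH X logv).Packet j vQ)}
  {qK : ∀ v : (thetaIndex X).V, v ∈ (thetaIndex X).Vbad → Set ((logShellsDH X logv).StarPacket v)}

/-- The re-typed container at the Dupuy–Hilado binders satisfies the generator hypotheses (c312-5's
`generatorsPreserve_summandPiecesDH`, same data). [cite: DupuyHilado2025, §4.7, §4.9] -/
theorem generatorsPreserve_summandPiecesReal_DH :
    (summandPiecesReal X hlog stripAutDH (ismDH logv) refl_mem_stripAutDH (refl_mem_ismDH logv)).GeneratorsPreserve :=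
  generatorsPreserve_summandPiecesDH X hlog

/-- **X-06-REAL IS NON-VACUOUS — `honestDH_not_indCoversQ`.** At the Dupuy–Hilado (Ind1)/(Ind2) binders (`stripAutDH`, `ismDH`:
lattice ISOMETRIES), for every column family and every pinned reading of the honest setting, NO element of `⟨(Ind1) ∪ (Ind2)⟩`
carries a Θ-datum region over the `q`-datum region — E-t43's `not_indCoversQ_of_realizes` with its three honest-packet binders
supplied at `(j = 1, v_ℚ = p)`: S is unreachable by indeterminacy moves AT AN INHABITED honest real setting. Located, not
adjudicated. [claim: Mochizuki2012, status: disputed] [cite: DupuyHilado2025, §4.9] -/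
theorem honestDH_not_indCoversQ
    (hΘpin : ∀ (m : ℤ) (j : (thetaIndex X).Label) (vQ : (thetaIndex X).VQ),
      (honestSetting X hlog stripAutDH (ismDH logv) refl_mem_stripAutDH (refl_mem_ismDH logv) M archPk archSub Ψ act Mmod
          region col n p).thetaRegion m j vQ = ρ ((col n).frobΨ m) j vQ)
    (hqpin : ∀ (j : (thetaIndex X).Label) (vQ : (thetaIndex X).VQ),
      (honestSetting X hlog stripAutDH (ismDH logv) refl_mem_stripAutDH (refl_mem_ismDH logv) M archPk archSub Ψ act Mmod
          region col n p).qRegion j vQ = ρ qK j vQ) :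
    ¬ IndCoversQ (latticeSituationReal X hlog stripAutDH (ismDH logv) refl_mem_stripAutDH (refl_mem_ismDH logv) M archPk
        archSub Ψ act Mmod region col)
      (honestSetting X hlog stripAutDH (ismDH logv) refl_mem_stripAutDH (refl_mem_ismDH logv) M archPk archSub Ψ act Mmod
        region col n p) ρ qK :=
  not_indCoversQ_of_realizes (i := ⟨0, lt_of_lt_of_le Nat.zero_lt_two (thetaIndex X).two_le_lstar⟩) (vQ := .inr (ratPrime p))
    (realizes_latticeSituationReal X hlog stripAutDH (ismDH logv) refl_mem_stripAutDH (refl_mem_ismDH logv) M archPk archSub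
      Ψ act Mmod region col n)
    (generatorsPreserve_summandPiecesReal_DH X hlog) (honest_hq ρ qK hqpin _ _) (fun m => honest_hΘ ρ hΘpin m _ _)
    (fun m => honest_hlt ρ qK hΘpin hqpin m _)

end DH

end Summit.ABC.IUTFork.Joshi

end
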